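import Mathlib
import Literature.NumberTheory.Transcendental.SemialgebraicMapsProofs
import Summits.KontsevichZagierPeriods.KontsevichZagierPeriods.Theorems.ScissorsTransportPolytopeTransportBox

/-!
# Polytope transport — stacking transports along the first coordinate

Helper file for `PolytopeTransport` (stmt-KontsevichZagierPeriods-10815, route ScissorsTransport).
If two disjoint open sets `A`, `B ⊆ ℝⁿ⁺¹` are transported onto the boxes of lengths `V`, `W`
(`Transport`, file `…Box`), then `A ∪ B` is transported onto the box of length `V + W`: keep the
transport of `A` and translate that of `B` by `V e₀` (the wall `{y₀ = V}` is the null set lost).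
Iterating over a finite disjoint family gives `exists_transport_biUnion`. Folklore bookkeeping
(piecewise semialgebraic maps, locality of derivatives within sets, translation invariance and
`Measure.pi_hyperplane`).
-/

noncomputable section

open Set MvPolynomial MeasureTheory Filter
open scoped Topology
open Literature.NumberTheory.Transcendental
open Literature.NumberTheory.Transcendental.KZ (unitCube mem_unitCube isOpen_unitCube)
open Literature.ModelTheory.ExponentialFields (IsSemialgebraic isSemialgebraic_univ
  isSemialgebraic_empty)

namespace Summit.KontsevichZagierPeriods.ScissorsTransport.PolytopeTransport

variable {n : ℕ}

/-! ### Semialgebraic bookkeeping -/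

/-- A piecewise map, semialgebraic on each of two semialgebraic pieces, is semialgebraic on their
union. [folklore] -/
theorem isSemialgebraicMapOn_piecewise {m : ℕ} {s t : Set (Fin m → ℝ)} {f g : (Fin m → ℝ) → (Fin m → ℝ)}
    [DecidablePred (· ∈ s)] (hs : IsSemialgebraic ℚ s) (ht : IsSemialgebraic ℚ t)
    (hf : IsSemialgebraicMapOn ℚ s f) (hg : IsSemialgebraicMapOn ℚ t g) :
    IsSemialgebraicMapOn ℚ (s ∪ t) (fun x => if x ∈ s then f x else g x) := by
  have hg' : IsSemialgebraicMapOn ℚ (t \ s) g := hg.mono Set.sdiff_subset (ht.diff hs)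
  unfold IsSemialgebraicMapOn at hf hg' ⊢
  convert hf.union hg' using 1
  ext z
  simp only [mem_setOf_eq, mem_union, Set.mem_sdiff]
  constructor
  · rintro ⟨x, hx, rfl⟩
    by_cases hxs : x ∈ s
    · exact Or.inl ⟨x, hxs, by rw [if_pos hxs]⟩
    · exact Or.inr ⟨x, ⟨hx.resolve_left hxs, hxs⟩, by rw [if_neg hxs]⟩
  · rintro (⟨x, hx, rfl⟩ | ⟨x, hx, rfl⟩)
    · exact ⟨x, Or.inl hx, by rw [if_pos hx]⟩
    · exact ⟨x, Or.inr hx.1, by rw [if_neg hx.2]⟩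

/-- Translation by a rational vector is `ℚ`-semialgebraic. [folklore] -/
theorem isSemialgebraicMapOn_add_const {m : ℕ} {s : Set (Fin m → ℝ)} (hs : IsSemialgebraic ℚ s)
    (v : Fin m → ℚ) : IsSemialgebraicMapOn ℚ s (fun x : Fin m → ℝ => x + fun i => (v i : ℝ)) := by
  convert isSemialgebraicMapOn_aeval hs (fun i : Fin m => (X i + C (v i) : MvPolynomial (Fin m) ℚ))
    using 2 with x
  ext i
  simp

/-- The identity is a transport of the empty set onto the empty box. [folklore] -/
def Transport.empty (n : ℕ) : Transport (∅ : Set (Fin (n + 1) → ℝ)) 0 where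
  toFun := id
  invFun := id
  deriv := fun _ => ContinuousLinearMap.id ℝ _
  derivInv := fun _ => ContinuousLinearMap.id ℝ _
  sa_set := isSemialgebraic_empty
  sa := by
    unfold IsSemialgebraicMapOn
    convert (isSemialgebraic_empty (k := ℚ) (R := ℝ) (ι := Fin (n + 1 + (n + 1)))) using 1
    ext z
    simp
  sa_inv := by
    unfold IsSemialgebraicMapOn
    convert (isSemialgebraic_empty (k := ℚ) (R := ℝ) (ι := Fin (n + 1 + (n + 1)))) using 1
    ext z
    simp
  hasFDerivWithinAt := fun _ h => h.elim
  hasFDerivWithinAt_inv := by simp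
  abs_det := fun _ h => h.elim
  abs_det_inv := by simp
  left_inv := fun _ h => h.elim
  image_subset := by simp
  null := by
    rw [image_empty, Set.sdiff_empty, Rat.cast_zero, volume_box]
    simp

/-! ### Gluing two transports -/

section Glue

variable {A B : Set (Fin (n + 1) → ℝ)} {V W : ℚ}

/-- The first coordinate on a box of length `V` lies in `(0, V)`. [folklore] -/
theorem mem_box_zero {V : ℝ} {y : Fin (n + 1) → ℝ} (hy : y ∈ box n V) : y 0 ∈ Ioo 0 V := hy.1

/-- The wall `{y₀ = V}` is a null set. [folklore] -/
theorem volume_wall (V : ℝ) : volume {y : Fin (n + 1) → ℝ | y 0 = V} = 0 := by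
  have := Measure.pi_hyperplane (fun _ : Fin (n + 1) => (volume : Measure ℝ)) 0 V
  simpa [volume_pi] using this

/-- **Gluing.** Transports of disjoint open sets `A`, `B` onto boxes of lengths `V`, `W` glue to a
transport of `A ∪ B` onto the box of length `V + W` (translate the second by `V e₀`).
[folklore] -/
theorem exists_transport_union (TA : Transport A V) (TB : Transport B W) (hA : IsOpen A)
    (hB : IsOpen B) (hAB : Disjoint A B) (hV : 0 ≤ V) (hW : 0 ≤ W) :
    Nonempty (Transport (A ∪ B) (V + W)) := by
  classical
  -- the translation vector and its basic properties
  set v : Fin (n + 1) → ℝ := fun i => ((Pi.single 0 V : Fin (n + 1) → ℚ) i : ℝ) with hv_def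
  have hv0 : v 0 = V := by simp [hv_def]
  have hvs : ∀ j : Fin n, v j.succ = 0 := fun j => by simp [hv_def, Fin.succ_ne_zero]
  have hadd0 : ∀ y : Fin (n + 1) → ℝ, (y + v) 0 = y 0 + V := fun y => by simp [hv0]
  have hsub0 : ∀ y : Fin (n + 1) → ℝ, (y - v) 0 = y 0 - V := fun y => by simp [hv0]
  have htail_add : ∀ y : Fin (n + 1) → ℝ, Fin.tail (y + v) = Fin.tail y := fun y => by
    ext j; simp [Fin.tail, hvs]
  have htail_sub : ∀ y : Fin (n + 1) → ℝ, Fin.tail (y - v) = Fin.tail y := fun y => by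
    ext j; simp [Fin.tail, hvs]
  -- names
  set s := TA.toFun '' A with hs_def
  set t := (fun y => y + v) '' (TB.toFun '' B) with ht_def
  have hs_box : s ⊆ box n V := TA.image_subset
  have hV' : (0 : ℝ) ≤ V := by exact_mod_cast hV
  have hW' : (0 : ℝ) ≤ W := by exact_mod_cast hW
  have ht_box : ∀ y ∈ t, (V : ℝ) < y 0 ∧ y 0 < V + W ∧ Fin.tail y ∈ unitCube n := by
    rintro _ ⟨y, hy, rfl⟩
    have hyb := TB.image_subset hy
    dsimp only
    refine ⟨?_, ?_, ?_⟩
    · rw [hadd0]; linarith [hyb.1.1]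
    · rw [hadd0]; linarith [hyb.1.2]
    · rw [htail_add]; exact hyb.2
  have hs0 : ∀ y ∈ s, y 0 < V := fun y hy => (hs_box hy).1.2
  have hst : Disjoint s t := by
    rw [disjoint_left]
    intro y hys hyt
    exact (lt_irrefl _ ((hs0 y hys).trans (ht_box y hyt).1))
  have hns : ∀ y ∈ t, y ∉ closure s := by
    intro y hy hcl
    have hcl' : y ∈ closure {z : Fin (n + 1) → ℝ | z 0 ≤ V} :=
      closure_mono (fun z hz => (hs0 z hz).le) hcl
    rw [(isClosed_le (continuous_apply 0) continuous_const).closure_eq] at hcl'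
    exact (not_le.2 (ht_box y hy).1) hcl'
  have hnt : ∀ y ∈ s, y ∉ closure t := by
    intro y hy hcl
    have hcl' : y ∈ closure {z : Fin (n + 1) → ℝ | (V : ℝ) ≤ z 0} :=
      closure_mono (fun z hz => (ht_box z hz).1.le) hcl
    rw [(isClosed_le continuous_const (continuous_apply 0)).closure_eq] at hcl'
    exact (not_le.2 (hs0 y hy)) hcl'
  -- the glued maps
  set Ψ : (Fin (n + 1) → ℝ) → (Fin (n + 1) → ℝ) := fun x => if x ∈ A then TA.toFun x else TB.toFun x + v
    with hΨ_def
  set Ψi : (Fin (n + 1) → ℝ) → (Fin (n + 1) → ℝ) := fun y => if y ∈ s then TA.invFun y else TB.invFun (y - v)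
    with hΨi_def
  have hΨA : ∀ x ∈ A, Ψ x = TA.toFun x := fun x hx => by simp [hΨ_def, hx]
  have hΨB : ∀ x ∈ B, Ψ x = TB.toFun x + v := fun x hx => by
    simp [hΨ_def, Disjoint.notMem_of_mem_right hAB hx]
  have himgA : Ψ '' A = s := by
    rw [hs_def]; exact image_congr fun x hx => hΨA x hx
  have himgB : Ψ '' B = t := by
    rw [ht_def, image_image]; exact image_congr fun x hx => hΨB x hx
  have himg : Ψ '' (A ∪ B) = s ∪ t := by rw [image_union, himgA, himgB]
  have hΨis : ∀ y ∈ s, Ψi y = TA.invFun y := fun y hy => by simp [hΨi_def, hy]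
  have hΨit : ∀ y ∈ t, Ψi y = TB.invFun (y - v) := fun y hy => by
    simp [hΨi_def, hst.notMem_of_mem_right hy]
  refine ⟨{
    toFun := Ψ
    invFun := Ψi
    deriv := fun x => if x ∈ A then TA.deriv x else TB.deriv x
    derivInv := fun y => if y ∈ s then TA.derivInv y else TB.derivInv (y - v)
    sa_set := TA.sa_set.union TB.sa_set
    sa := ?_, sa_inv := ?_, hasFDerivWithinAt := ?_, hasFDerivWithinAt_inv := ?_, abs_det := ?_
    abs_det_inv := ?_, left_inv := ?_, image_subset := ?_, null := ?_ }⟩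
  · -- semialgebraic
    refine isSemialgebraicMapOn_piecewise TA.sa_set TB.sa_set TA.sa ?_
    exact IsSemialgebraicMapOn.comp_holds (isSemialgebraicMapOn_add_const isSemialgebraic_univ _)
      TB.sa (mapsTo_univ _ _)
  · -- semialgebraic inverse
    rw [himg]
    have hssa : IsSemialgebraic ℚ s := IsSemialgebraicMapOn.isSemialgebraic_image_holds TA.sa
      Subset.rfl TA.sa_set
    have htBsa : IsSemialgebraic ℚ (TB.toFun '' B) :=
      IsSemialgebraicMapOn.isSemialgebraic_image_holds TB.sa Subset.rfl TB.sa_set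
    have htsa : IsSemialgebraic ℚ t :=
      IsSemialgebraicMapOn.isSemialgebraic_image_holds (isSemialgebraicMapOn_add_const htBsa _)
        Subset.rfl htBsa
    refine isSemialgebraicMapOn_piecewise hssa htsa TA.sa_inv ?_
    have hsub : IsSemialgebraicMapOn ℚ t (fun y : Fin (n + 1) → ℝ => y - v) := by
      have := isSemialgebraicMapOn_add_const htsa (-(Pi.single 0 V : Fin (n + 1) → ℚ))
      refine this.congr fun y _ => ?_
      simp only [hv_def, sub_eq_add_neg]
      congr 1
      ext i
      simp
    refine IsSemialgebraicMapOn.comp_holds TB.sa_inv hsub ?_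
    rintro _ ⟨y, hy, rfl⟩
    simpa using hy
  · -- derivative
    rintro x (hx | hx)
    · have h1 : HasFDerivAt TA.toFun (TA.deriv x) x :=
        (TA.hasFDerivWithinAt x hx).hasFDerivAt (hA.mem_nhds hx)
      have h2 : HasFDerivAt Ψ (TA.deriv x) x := by
        refine h1.congr_of_eventuallyEq ?_
        filter_upwards [hA.mem_nhds hx] with y hy using hΨA y hy
      simpa [hx] using h2.hasFDerivWithinAt
    · have hxA : x ∉ A := Disjoint.notMem_of_mem_right hAB hx
      have h1 : HasFDerivAt TB.toFun (TB.deriv x) x :=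
        (TB.hasFDerivWithinAt x hx).hasFDerivAt (hB.mem_nhds hx)
      have h2 : HasFDerivAt Ψ (TB.deriv x) x := by
        refine (h1.add_const v).congr_of_eventuallyEq ?_
        filter_upwards [hB.mem_nhds hx] with y hy using hΨB y hy
      simpa [hxA] using h2.hasFDerivWithinAt
  · -- derivative of the inverse
    rw [himg]
    rintro y (hy | hy)
    · have h1 : HasFDerivWithinAt Ψi (TA.derivInv y) s y :=
        (TA.hasFDerivWithinAt_inv y hy).congr (fun y' hy' => hΨis y' hy') (hΨis y hy)
      have h2 : HasFDerivWithinAt Ψi (TA.derivInv y) t y := HasFDerivWithinAt.of_notMem_closure (hnt y hy)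
      simpa [hy] using h1.union h2
    · obtain ⟨y', hy', rfl⟩ := hy
      have hys : y' + v ∉ s := hst.notMem_of_mem_right ⟨y', hy', rfl⟩
      have hmaps : MapsTo (fun z : Fin (n + 1) → ℝ => z - v) t (TB.toFun '' B) := by
        rintro _ ⟨z, hz, rfl⟩; simpa using hz
      have h0 : HasFDerivWithinAt TB.invFun (TB.derivInv y') (TB.toFun '' B) ((y' + v) - v) := by
        simpa using TB.hasFDerivWithinAt_inv y' hy'
      have h1 : HasFDerivWithinAt (fun z => TB.invFun (z - v)) (TB.derivInv y') t (y' + v) := by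
        have := h0.comp (y' + v) ((hasFDerivWithinAt_id (y' + v) t).sub_const v) hmaps
        simpa using this
      have h2 : HasFDerivWithinAt Ψi (TB.derivInv y') t (y' + v) :=
        h1.congr (fun z hz => hΨit z hz) (hΨit _ ⟨y', hy', rfl⟩)
      have h3 : HasFDerivWithinAt Ψi (TB.derivInv y') s (y' + v) :=
        HasFDerivWithinAt.of_notMem_closure (hns _ ⟨y', hy', rfl⟩)
      simpa [hys] using h3.union h2
  · -- |det| = 1
    rintro x (hx | hx)
    · simpa [hx] using TA.abs_det x hx
    · simpa [Disjoint.notMem_of_mem_right hAB hx] using TB.abs_det x hx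
  · -- |det| = 1 for the inverse
    rw [himg]
    rintro y (hy | hy)
    · simpa [hy] using TA.abs_det_inv y hy
    · have hys : y ∉ s := hst.notMem_of_mem_right hy
      obtain ⟨y', hy', rfl⟩ := hy
      simpa [hys] using TB.abs_det_inv y' hy'
  · -- left inverse
    rintro x (hx | hx)
    · rw [hΨA x hx, hΨis _ ⟨x, hx, rfl⟩, TA.left_inv x hx]
    · rw [hΨB x hx, hΨit _ ⟨TB.toFun x, ⟨x, hx, rfl⟩, rfl⟩, add_sub_cancel_right, TB.left_inv x hx]
  · -- image in the big box
    rw [himg]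
    rintro y (hy | hy)
    · have hyb := hs_box hy
      exact ⟨⟨hyb.1.1, by push_cast; linarith [hyb.1.2]⟩, hyb.2⟩
    · obtain ⟨h1, h2, h3⟩ := ht_box y hy
      exact ⟨⟨by linarith, by push_cast; linarith⟩, h3⟩
  · -- full measure
    rw [himg]
    have hcover : box n ((V + W : ℚ) : ℝ) \ (s ∪ t) ⊆
        (box n V \ s) ∪ ((fun y => y + v) '' (box n W \ TB.toFun '' B)) ∪ {y | y 0 = V} := by
      intro y hy
      obtain ⟨hyb, hyst⟩ := hy
      rw [mem_union, not_or] at hyst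
      rcases lt_trichotomy (y 0) V with h | h | h
      · exact Or.inl (Or.inl ⟨⟨⟨hyb.1.1, h⟩, hyb.2⟩, hyst.1⟩)
      · exact Or.inr h
      · refine Or.inl (Or.inr ⟨y - v, ⟨⟨⟨?_, ?_⟩, ?_⟩, ?_⟩, sub_add_cancel y v⟩)
        · rw [hsub0]; linarith
        · rw [hsub0]; have := hyb.1.2; push_cast at this; linarith
        · rw [htail_sub]; exact hyb.2
        · intro hmem
          exact hyst.2 ⟨y - v, hmem, sub_add_cancel y v⟩
    refine measure_mono_null hcover (measure_union_null (measure_union_null TA.null ?_) (volume_wall _))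
    have htrans : (fun y => y + v) '' (box n W \ TB.toFun '' B) = (fun y => y + (-v)) ⁻¹' (box n W \ TB.toFun '' B) := by
      ext y; simp
    rw [htrans, measure_preimage_add_right]
    exact TB.null

end Glue

/-! ### Finite disjoint unions -/

/-- **Stacking.** A finite pairwise disjoint family of open sets, each transported onto the box of
length `V i ≥ 0`, has its union transported onto the box of length `∑ V i`. [folklore] -/
theorem exists_transport_biUnion {ι : Type*} (S : Finset ι) (A : ι → Set (Fin (n + 1) → ℝ))
    (V : ι → ℚ) (T : ∀ i, Transport (A i) (V i)) (hopen : ∀ i, IsOpen (A i))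
    (hV : ∀ i, 0 ≤ V i) (hdisj : (S : Set ι).PairwiseDisjoint A) :
    Nonempty (Transport (⋃ i ∈ S, A i) (∑ i ∈ S, V i)) := by
  classical
  induction S using Finset.induction_on with
  | empty => simpa using ⟨Transport.empty n⟩
  | insert a S ha ih =>
    have hdisj' : ((S : Set ι)).PairwiseDisjoint A :=
      hdisj.subset (by simp)
    obtain ⟨TS⟩ := ih hdisj'
    have hAS : Disjoint (A a) (⋃ i ∈ S, A i) := by
      rw [disjoint_iUnion₂_right]
      intro i hi
      exact hdisj (by simp) (by simp [hi]) (fun h => ha (h ▸ hi))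
    have hopenS : IsOpen (⋃ i ∈ S, A i) := isOpen_biUnion fun i _ => hopen i
    obtain ⟨T⟩ := exists_transport_union (T a) TS (hopen a) hopenS hAS (hV a)
      (Finset.sum_nonneg fun i _ => hV i)
    rw [Finset.set_biUnion_insert, Finset.sum_insert ha]
    exact ⟨T⟩

end Summit.KontsevichZagierPeriods.ScissorsTransport.PolytopeTransport
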